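import Mathlib
import Literature.Probability.Distributions.CharFunInversion
import Summits.AtomisticToContinuum.FouriersLaw.Theorems.DrudeDissolution.Negative.SpectralPairNecessities
import HarnessLib

/-!
# Stub S1 `stub_integrableSpectralCriterion` of line `Sketch`, crux `EmbeddedDrudeMourre.DrudeDissolution`
(stmt-AtomisticToContinuum-12593): an integrable cosine transform has a Drude window

Pure real analysis (`--supports stmt-AtomisticToContinuum-12593`). If `σ` is a finite measure on `ℝ`
with cosine transform `C(t) = ∫ cos(ωt) dσ(ω)`, `C ∈ L¹(0,∞)` and `∫₀^∞ C > 0`, then the SYMMETRISED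
measure `τ = σ + σ̌` has characteristic function `2C ∈ L¹(ℝ)`, hence (inversion theorem for finite
measures with integrable characteristic function, in tree:
`Literature.Probability.Distributions.eq_withDensity_fourierDensity_of_integrable_charFun`) a
continuous non-negative integrable density `f_τ` with `f_τ(0) = (2π)⁻¹ ∫ 2C = (2/π) ∫₀^∞ C > 0`; the
measure `σ' = ½ f_τ dω` has cosine transform `C` and the window `(−1, 1)` (indeed every window).

## Contents
* `integrable_of_even_of_integrableOn_Ioi`, `integral_eq_two_mul_setIntegral_Ioi` —
  bookkeeping for an even `C` integrable on `(0, ∞)`;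
* `norm_cexp_real_mul_I`, `charFun_add_map_neg` — `charFun (σ + σ̌) t = 2 C t`;
* `integral_withDensity_ofReal_mul` — `∫ g d(f·vol) = ∫ f g` for continuous `f ≥ 0`;
* `stub_integrableSpectralCriterion` — the registered stub, verbatim.
-/

noncomputable section

open MeasureTheory Filter Set Complex
open scoped Topology ENNReal NNReal Real

namespace Summit.AtomisticToContinuum.FouriersLaw.Theorems.DrudeDissolution.LineSketch

open Literature.Probability.Distributions

variable {σ : Measure ℝ} {C : ℝ → ℝ}

/-- An even function integrable on `(0, ∞)` is integrable on `ℝ`. -/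
theorem integrable_of_even_of_integrableOn_Ioi (heven : ∀ t : ℝ, C (-t) = C t)
    (hint : IntegrableOn C (Ioi 0)) : Integrable C := by
  have hneg : IntegrableOn C (Iio 0) := by
    have hmp : MeasurePreserving (fun t : ℝ => -t) volume volume :=
      Measure.measurePreserving_neg (volume : Measure ℝ)
    have hme : MeasurableEmbedding (fun t : ℝ => -t) := (MeasurableEquiv.neg ℝ).measurableEmbedding
    have h := (hmp.integrableOn_comp_preimage hme (f := C) (s := Ioi 0)).2 hint
    have hpre : (fun t : ℝ => -t) ⁻¹' Ioi 0 = Iio 0 := by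
      ext t; simp
    have hcomp : (C ∘ fun t : ℝ => -t) = C := funext fun t => heven t
    rwa [hpre, hcomp] at h
  have hIic : IntegrableOn C (Iic 0) :=
    (integrableOn_Iic_iff_integrableOn_Iio (μ := volume) (f := C) (b := (0 : ℝ))).2 hneg
  have h := hIic.union hint
  rwa [Iic_union_Ioi, integrableOn_univ] at h

/-- For an even function integrable on `(0, ∞)`: `∫_ℝ C = 2 ∫₀^∞ C`. -/
theorem integral_eq_two_mul_setIntegral_Ioi (heven : ∀ t : ℝ, C (-t) = C t)
    (hint : IntegrableOn C (Ioi 0)) : ∫ t, C t = 2 * ∫ t in Ioi (0 : ℝ), C t := by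
  have hIic : IntegrableOn C (Iic 0) :=
    (integrable_of_even_of_integrableOn_Ioi heven hint).integrableOn
  have hsplit : ∫ t, C t = (∫ t in Iic (0 : ℝ), C t) + ∫ t in Ioi (0 : ℝ), C t := by
    rw [← setIntegral_union (Iic_disjoint_Ioi le_rfl) measurableSet_Ioi hIic hint, Iic_union_Ioi,
      setIntegral_univ]
  have hrefl : ∫ t in Iic (0 : ℝ), C t = ∫ t in Ioi (0 : ℝ), C t := by
    have h := integral_comp_neg_Ioi (0 : ℝ) C
    simp only [neg_zero] at h
    rw [← h]
    exact setIntegral_congr_fun measurableSet_Ioi fun t _ => heven t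
  rw [hsplit, hrefl]; ring

/-- `‖e^{i a}‖ = 1` in the form used below. -/
theorem norm_cexp_real_mul_I (a : ℝ) (x : ℝ) : ‖cexp ((a : ℂ) * x * I)‖ = 1 := by
  rw [show (a : ℂ) * x * I = ((a * x : ℝ) : ℂ) * I by push_cast; ring, Complex.norm_exp_ofReal_mul_I]

/-- The characteristic function of the symmetrised measure `σ + σ̌` is `2 C`. -/
theorem charFun_add_map_neg [IsFiniteMeasure σ] (hC : ∀ t : ℝ, C t = ∫ ω, Real.cos (ω * t) ∂σ)
    (t : ℝ) : charFun (σ + σ.map (fun ω : ℝ => -ω)) t = ((2 * C t : ℝ) : ℂ) := by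
  rw [charFun_apply_real]
  have hf : Continuous fun x : ℝ => cexp (t * x * I) := by fun_prop
  have hf' : Continuous fun x : ℝ => cexp (t * ((-x : ℝ) : ℂ) * I) := by fun_prop
  have hbound : ∀ (ν : Measure ℝ) [IsFiniteMeasure ν], Integrable (fun x : ℝ => cexp (t * x * I)) ν :=
    fun ν _ => (integrable_const (1 : ℝ)).mono' hf.aestronglyMeasurable
      (Eventually.of_forall fun x => (norm_cexp_real_mul_I t x).le)
  have hbound' : Integrable (fun x : ℝ => cexp (t * ((-x : ℝ) : ℂ) * I)) σ :=
    (integrable_const (1 : ℝ)).mono' hf'.aestronglyMeasurable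
      (Eventually.of_forall fun x => by
        rw [show (t : ℂ) * ((-x : ℝ) : ℂ) * I = (((-t) * x : ℝ) : ℂ) * I by push_cast; ring,
          Complex.norm_exp_ofReal_mul_I])
  rw [integral_add_measure (hbound σ) (hbound _),
    integral_map measurable_neg.aemeasurable hf.aestronglyMeasurable,
    ← integral_add (hbound σ) hbound']
  have hcos : ∀ x : ℝ, cexp (t * x * I) + cexp (t * ((-x : ℝ) : ℂ) * I) =
      ((2 * Real.cos (x * t) : ℝ) : ℂ) := by
    intro x
    rw [show (t : ℂ) * ((-x : ℝ) : ℂ) * I = -(t * x) * I by push_cast; ring,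
      show (t : ℂ) * x * I = (t * x) * I by ring, ← Complex.two_cos]
    push_cast
    rw [mul_comm (x : ℂ) t]
  simp_rw [hcos]
  rw [integral_complex_ofReal, hC t, ← integral_const_mul]

/-- Integration against `f · Lebesgue` for a continuous non-negative density `f`. -/
theorem integral_withDensity_ofReal_mul {f : ℝ → ℝ} (hf : Continuous f) (hf0 : ∀ x, 0 ≤ f x)
    (g : ℝ → ℝ) :
    ∫ x, g x ∂(volume.withDensity fun x => ENNReal.ofReal (f x)) = ∫ x, f x * g x := by
  have hm : Measurable fun v => (f v).toNNReal := hf.measurable.real_toNNReal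
  have := integral_withDensity_eq_integral_smul (μ := volume) hm g
  rw [show (volume.withDensity fun v => ENNReal.ofReal (f v)) =
    volume.withDensity (fun v => ((f v).toNNReal : ℝ≥0∞)) from rfl, this]
  congr 1 with v
  rw [NNReal.smul_def, Real.coe_toNNReal _ (hf0 v), smul_eq_mul]

/-- **S1 `stub_integrableSpectralCriterion`** (registered stub of line `Sketch`, crux
`EmbeddedDrudeMourre.DrudeDissolution`, verbatim): a finite measure `σ` on `ℝ` whose cosine transform
`C` is integrable on `(0,∞)` with `∫₀^∞ C > 0` admits a finite measure `σ'` with the same cosine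
transform and a window `(−δ, δ)` carrying a continuous density `g ≥ 0` with `g 0 > 0`. Proof:
`σ' = ½ f dω`, `f` the Fourier density of the symmetrised measure `σ + σ̌` (inversion theorem),
`δ = 1`, `g = f/2`, `g 0 = π⁻¹ ∫₀^∞ C`. -/
theorem stub_integrableSpectralCriterion :
    ∀ (σ : MeasureTheory.Measure ℝ) (C : ℝ → ℝ), MeasureTheory.IsFiniteMeasure σ →
      (∀ t : ℝ, C t = ∫ ω, Real.cos (ω * t) ∂σ) →
      MeasureTheory.IntegrableOn C (Set.Ioi 0) → 0 < ∫ t in Set.Ioi (0 : ℝ), C t →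
      ∃ σ' : MeasureTheory.Measure ℝ, MeasureTheory.IsFiniteMeasure σ' ∧
        (∀ t : ℝ, C t = ∫ ω, Real.cos (ω * t) ∂σ') ∧
        ∃ (δ : ℝ) (g : ℝ → ℝ), 0 < δ ∧ ContinuousOn g (Set.Ioo (-δ) δ) ∧
          (∀ ω ∈ Set.Ioo (-δ) δ, 0 ≤ g ω) ∧ 0 < g 0 ∧
          σ'.restrict (Set.Ioo (-δ) δ) =
            (MeasureTheory.volume.restrict (Set.Ioo (-δ) δ)).withDensity
              (fun ω => ENNReal.ofReal (g ω)) := by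
  intro σ C hσ hC hint hpos
  -- the symmetrised measure and its Fourier density
  set τ : Measure ℝ := σ + σ.map (fun ω : ℝ => -ω) with hτ
  haveI : IsFiniteMeasure τ := by rw [hτ]; infer_instance
  have heven : ∀ t : ℝ, C (-t) = C t := Negative.cosine_even hC
  have hCint : Integrable C := integrable_of_even_of_integrableOn_Ioi heven hint
  have hchar : charFun τ = fun t => ((2 * C t : ℝ) : ℂ) := funext (charFun_add_map_neg hC)
  have hcharint : Integrable (charFun τ) := by
    rw [hchar]
    exact (hCint.const_mul 2).ofReal
  have hFint : Integrable (fourierMeasure τ) := integrable_charFun_iff.1 hcharint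
  set f : ℝ → ℝ := fourierDensity τ with hf
  have hfcont : Continuous f := continuous_fourierDensity hFint
  have hf0 : ∀ x, 0 ≤ f x := fourierDensity_nonneg hFint
  have hfint : Integrable f := integrable_fourierDensity hFint
  have hτeq : τ = volume.withDensity (fun v => ENNReal.ofReal (f v)) :=
    eq_withDensity_fourierDensity_of_integrable_charFun hcharint
  have hfzero : f 0 = Real.pi⁻¹ * (2 * ∫ t in Ioi (0 : ℝ), C t) := by
    rw [hf, fourierDensity_zero hcharint, Module.finrank_self, pow_one, hchar]
    simp only [Complex.ofReal_re]
    rw [integral_const_mul, integral_eq_two_mul_setIntegral_Ioi heven hint]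
    ring
  -- the output measure `σ' = ½ f dω`
  set g : ℝ → ℝ := fun ω => f ω / 2 with hg
  have hgcont : Continuous g := hfcont.div_const 2
  have hg0 : ∀ x, 0 ≤ g x := fun x => div_nonneg (hf0 x) (by norm_num)
  have hgint : Integrable g := hfint.div_const 2
  refine ⟨volume.withDensity (fun ω => ENNReal.ofReal (g ω)), ?_, ?_, 1, g, one_pos,
    hgcont.continuousOn, fun ω _ => hg0 ω, ?_, ?_⟩
  · exact isFiniteMeasure_withDensity_ofReal hgint.2
  · intro t
    -- `∫ cos ∂σ' = ½ ∫ f cos = ½ ∫ cos ∂τ = ½ (C t + C t)`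
    rw [integral_withDensity_ofReal_mul hgcont hg0]
    have hτcos : ∫ ω, Real.cos (ω * t) ∂τ = 2 * C t := by
      have hcc : Continuous fun ω : ℝ => Real.cos (ω * t) := by fun_prop
      have hi1 : Integrable (fun ω : ℝ => Real.cos (ω * t)) σ :=
        (integrable_const (1 : ℝ)).mono' hcc.aestronglyMeasurable
          (Eventually.of_forall fun ω => by simpa using Real.abs_cos_le_one (ω * t))
      have hi2 : Integrable (fun ω : ℝ => Real.cos (ω * t)) (σ.map fun ω : ℝ => -ω) :=
        (integrable_const (1 : ℝ)).mono' hcc.aestronglyMeasurable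
          (Eventually.of_forall fun ω => by simpa using Real.abs_cos_le_one (ω * t))
      rw [hτ, integral_add_measure hi1 hi2,
        integral_map measurable_neg.aemeasurable hcc.aestronglyMeasurable]
      simp only [neg_mul, Real.cos_neg]
      rw [← hC t]; ring
    have hτcos' : ∫ ω, f ω * Real.cos (ω * t) = 2 * C t := by
      rw [← integral_withDensity_ofReal_mul hfcont hf0, ← hτeq, hτcos]
    have : (fun ω => g ω * Real.cos (ω * t)) = fun ω => (1 / 2 : ℝ) * (f ω * Real.cos (ω * t)) := by
      funext ω; simp only [hg]; ring
    rw [this, integral_const_mul, hτcos']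
    ring
  · show 0 < g 0
    have hg0' : g 0 = Real.pi⁻¹ * ∫ t in Ioi (0 : ℝ), C t := by
      simp only [hg, hfzero]; ring
    rw [hg0']
    exact mul_pos (inv_pos.mpr Real.pi_pos) hpos
  · exact restrict_withDensity (measurableSet_Ioo : MeasurableSet (Set.Ioo (-(1 : ℝ)) 1)) _

end Summit.AtomisticToContinuum.FouriersLaw.Theorems.DrudeDissolution.LineSketch

end
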